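import Literature.Analysis.PDE.HeatFreeFlowAdmissible
import Literature.Analysis.UnboundedOperators.HeatIteratedDerivBounds
import Literature.Analysis.Calculus.JointSmoothnessPartialsWithin
import Literature.Analysis.FunctionSpaces.IterDirDerivLeibniz
import Mathlib.Data.List.FinRange
import HarnessLib

/-!
# The free heat flow is smooth up to the initial time (topic `Analysis/PDE`)

Analytic layer of the programme to prove short-time existence for quasilinear strictly
parabolic systems on a closed manifold (hypothesis `hQL` of
`Literature.Geometry.Riemannian.ricciFlow_shortTime_existence_of_quasilinear`). Solutions of the
linear problems of that programme are assembled from the zero-initial-value Duhamel solution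
`v = 𝒱[Θ] - e^{νtΔ}(𝒱[Θ](0))`; to iterate (and to state the final result) they must be smooth on
the CLOSED time slab `[0, ∞) × E` in Mathlib's within sense. The forward Duhamel integral `𝒱` is
smooth on all of `ℝ × E`; this file proves that the free flow `(t, x) ↦ e^{νtΔ}h(x)` of an
admissible datum (`IsHeatAdmissible`, extended by `h` for `t ≤ 0`) is `C^∞` on
`[0, ∞) ×ˢ univ` (`contDiffOn_uncurry_freeFlow`), through the within-slab criterion
`contDiffOn_uncurry_of_mixed_partials_within` (`Calculus/JointSmoothnessPartialsWithin.lean`)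
applied to the fields `w l = νˡ e^{νtΔ}(Δˡh)`:

* spatial derivatives of every order fall on the data, at the level of the full Fréchet
  derivatives: `Dᵏ(e^{σΔ}g) = e^{σΔ}(Dᵏg)` (the tree's `iteratedFDeriv_heatExtension_of_bounded`,
  `UnboundedOperators/HeatIteratedDerivBounds.lean`; the datum `Dᵏg` is multilinear-map valued,
  which is why this file works with the general-codomain API of `heatExtension`);
* the Laplacian commutes with `Dᵏ` (`laplacian_iteratedFDeriv_eq`, Schwarz's theorem in the
  form of the tree's `iterDirDeriv_perm`), so that `∂ₜ Dᵏ(w l) = Dᵏ(w (l+1))` within `[0, ∞)`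
  (`hasDerivWithinAt_iteratedFDeriv_freeFlow`, one-sided at `t = 0` by
  `hasDerivWithinAt_Ici_of_tendsto_deriv`);
* `(t, x) ↦ Dᵏ(e^{νtΔ}g)(x)` is jointly continuous on `ℝ × E`
  (`continuous_iteratedFDeriv_freeFlow`, `tendsto_heatExtension_nhdsWithin_prod` at `t = 0`);
* operator norms of multilinear maps are controlled by their values on basis tuples
  (`ContinuousMultilinearMap.norm_le_sum_norm_apply_basis`), so that the operator norms
  `‖Dʲg‖` of an admissible datum are bounded.

Everything is proved; no named fact and no `sorry` is introduced.

## References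

* L. C. Evans, *Partial Differential Equations*, 2nd ed., AMS 2010, §2.3.1, Thm. 1 (the free
  heat flow is `C^∞` for `t > 0` and attains its initial datum; here for all derivatives).
  [Evans2010]
* J. Dieudonné, *Foundations of Modern Analysis*, Academic Press 1960, (8.12.x) (joint
  smoothness from partial derivatives).
-/

noncomputable section

open MeasureTheory Set Function Filter Topology TopologicalSpace Metric InnerProductSpace
open scoped RealInnerProductSpace Laplacian ContDiff

namespace Literature.Analysis.PDE

open Literature.Analysis.UnboundedOperators Literature.Analysis.FunctionSpaces
  Literature.Analysis.Calculus

variable {E : Type*} [NormedAddCommGroup E] [InnerProductSpace ℝ E] [FiniteDimensional ℝ E]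
  [MeasurableSpace E] [BorelSpace E]
variable {F : Type*} [NormedAddCommGroup F] [NormedSpace ℝ F]

/-! ### Iterated Fréchet derivatives as iterated directional derivatives -/

section IterDir

omit [InnerProductSpace ℝ E] [FiniteDimensional ℝ E] [MeasurableSpace E] [BorelSpace E] in
/-- The full iterated derivative on a tuple of directions is the iterated directional derivative
along the list of these directions (smooth `f`). [folklore] -/
theorem iteratedFDeriv_apply_eq_iterDirDeriv_ofFn [NormedSpace ℝ E] {f : E → F} (hf : ContDiff ℝ ∞ f)
    {n : ℕ} (x : E) (v : Fin n → E) :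
    iteratedFDeriv ℝ n f x v = iterDirDeriv (List.ofFn v) f x := by
  rw [iterDirDeriv_eq_iteratedFDeriv hf]
  have key : ∀ {m : ℕ} (h : m = n) (w : Fin m → E), (∀ i, w i = v (Fin.cast h i)) →
      iteratedFDeriv ℝ m f x w = iteratedFDeriv ℝ n f x v := by
    rintro m rfl w hw
    congr 1
    funext i
    exact hw i
  exact (key (List.length_ofFn (f := v)) _ fun i ↦ List.get_ofFn v i).symm

omit [InnerProductSpace ℝ E] [FiniteDimensional ℝ E] [MeasurableSpace E] [BorelSpace E] in
/-- Function form: `(y ↦ Dⁿf(y) v) = ∂_{ofFn v} f`. [folklore] -/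
theorem iteratedFDeriv_apply_eq_iterDirDeriv_ofFn' [NormedSpace ℝ E] {f : E → F} (hf : ContDiff ℝ ∞ f)
    {n : ℕ} (v : Fin n → E) :
    (fun y ↦ iteratedFDeriv ℝ n f y v) = iterDirDeriv (List.ofFn v) f :=
  funext fun y ↦ iteratedFDeriv_apply_eq_iterDirDeriv_ofFn hf y v

omit [InnerProductSpace ℝ E] [FiniteDimensional ℝ E] [MeasurableSpace E] [BorelSpace E] in
/-- Iterated directional derivatives commute with left composition by a continuous linear map
(smooth `f`). [folklore] -/
theorem iterDirDeriv_clm_comp [NormedSpace ℝ E] {G : Type*} [NormedAddCommGroup G] [NormedSpace ℝ G]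
    (L : F →L[ℝ] G) {f : E → F} (hf : ContDiff ℝ ∞ f) :
    ∀ β : List E, iterDirDeriv β (fun y ↦ L (f y)) = fun y ↦ L (iterDirDeriv β f y)
  | [] => rfl
  | v :: β => by
    rw [iterDirDeriv_cons, iterDirDeriv_cons, iterDirDeriv_clm_comp L hf β]
    funext y
    have hd : DifferentiableAt ℝ (iterDirDeriv β f) y :=
      ((contDiff_iterDirDeriv hf β).differentiable (by simp)) y
    rw [show (fun y ↦ L (iterDirDeriv β f y)) = L ∘ iterDirDeriv β f from rfl,
      (L.hasFDerivAt.comp y hd.hasFDerivAt).fderiv]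
    rfl

omit [InnerProductSpace ℝ E] [FiniteDimensional ℝ E] [MeasurableSpace E] [BorelSpace E] in
/-- Concatenation of words: `∂_{β ++ β'} f = ∂_β (∂_{β'} f)`. [folklore] -/
theorem iterDirDeriv_append [NormedSpace ℝ E] (β β' : List E) (f : E → F) :
    iterDirDeriv (β ++ β') f = iterDirDeriv β (iterDirDeriv β' f) := by
  induction β with
  | nil => rfl
  | cons v β ih => simp only [List.cons_append, iterDirDeriv_cons, ih]

omit [InnerProductSpace ℝ E] [FiniteDimensional ℝ E] [MeasurableSpace E] [BorelSpace E] in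
/-- Iterated directional derivatives of finite sums of smooth functions. [folklore] -/
theorem iterDirDeriv_finset_sum [NormedSpace ℝ E] {ι : Type*} (s : Finset ι) {f : ι → E → F}
    (hf : ∀ i ∈ s, ContDiff ℝ ∞ (f i)) (β : List E) :
    iterDirDeriv β (fun y ↦ ∑ i ∈ s, f i y) = fun y ↦ ∑ i ∈ s, iterDirDeriv β (f i) y := by
  classical
  induction s using Finset.induction_on with
  | empty =>
    simp only [Finset.sum_empty]
    cases β with
    | nil => rfl
    | cons v β => exact iterDirDeriv_const_of_ne_nil (0 : F) (List.cons_ne_nil v β)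
  | insert a s ha ih =>
    have hfa := hf a (Finset.mem_insert_self a s)
    have hfs : ∀ i ∈ s, ContDiff ℝ ∞ (f i) := fun i hi ↦ hf i (Finset.mem_insert_of_mem hi)
    have hsum : ContDiff ℝ ∞ fun y ↦ ∑ i ∈ s, f i y := ContDiff.sum fun i hi ↦ hfs i hi
    simp only [Finset.sum_insert ha]
    rw [show (fun y ↦ f a y + ∑ i ∈ s, f i y) = (f a) + fun y ↦ ∑ i ∈ s, f i y from rfl,
      iterDirDeriv_add hfa hsum, ih hfs]
    rfl

omit [MeasurableSpace E] [BorelSpace E] in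
/-- **The Laplacian in words**: `Δg = Σᵢ ∂_{[eᵢ, eᵢ]} g` for smooth `g` (any normed codomain).
[folklore] -/
theorem laplacian_eq_sum_iterDirDeriv {g : E → F} (hg : ContDiff ℝ ∞ g) :
    Δ g = fun y ↦ ∑ i, iterDirDeriv [stdOrthonormalBasis ℝ E i, stdOrthonormalBasis ℝ E i] g y := by
  rw [laplacian_eq_iteratedFDeriv_stdOrthonormalBasis]
  funext y
  refine Finset.sum_congr rfl fun i _ ↦ ?_
  rw [iteratedFDeriv_apply_eq_iterDirDeriv_ofFn hg]
  simp

omit [MeasurableSpace E] [BorelSpace E] in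
/-- **The Laplacian commutes with iterated derivatives** (Schwarz): for smooth `g`,
`Δ(Dᵏg)(x) = Dᵏ(Δg)(x)`. [folklore] -/
theorem laplacian_iteratedFDeriv_eq {g : E → F} (hg : ContDiff ℝ ∞ g) (k : ℕ) (x : E) :
    (Δ (iteratedFDeriv ℝ k g)) x = iteratedFDeriv ℝ k (Δ g) x := by
  set b := stdOrthonormalBasis ℝ E
  have hgk : ContDiff ℝ ∞ (iteratedFDeriv ℝ k g) := hg.iteratedFDeriv_right (by norm_cast)
  have hgl : ContDiff ℝ ∞ (Δ g) := by
    rw [laplacian_eq_sum_iterDirDeriv hg]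
    exact ContDiff.sum fun i _ ↦ contDiff_iterDirDeriv hg _
  ext m
  -- left: `Σᵢ ∂_{[eᵢ,eᵢ]}(Dᵏg)(x) m = Σᵢ ∂_{[eᵢ,eᵢ] ++ ofFn m} g (x)`
  have hL : (Δ (iteratedFDeriv ℝ k g)) x m = ∑ i, iterDirDeriv ([b i, b i] ++ List.ofFn m) g x := by
    rw [laplacian_eq_sum_iterDirDeriv hgk]
    simp only [FunLike.coe_sum, Finset.sum_apply]
    refine Finset.sum_congr rfl fun i _ ↦ ?_
    have h1 := iterDirDeriv_clm_comp (ContinuousMultilinearMap.apply ℝ (fun _ : Fin k ↦ E) F m) hgk [b i, b i]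
    have h2 : iterDirDeriv [b i, b i] (fun y ↦ iteratedFDeriv ℝ k g y m) x =
        iterDirDeriv [b i, b i] (iteratedFDeriv ℝ k g) x m := congrFun h1 x
    rw [← h2, iteratedFDeriv_apply_eq_iterDirDeriv_ofFn' hg, iterDirDeriv_append]
  -- right: `Dᵏ(Δg)(x) m = ∂_{ofFn m}(Σᵢ ∂_{[eᵢ,eᵢ]} g)(x) = Σᵢ ∂_{ofFn m ++ [eᵢ,eᵢ]} g (x)`
  have hR : iteratedFDeriv ℝ k (Δ g) x m = ∑ i, iterDirDeriv (List.ofFn m ++ [b i, b i]) g x := by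
    rw [iteratedFDeriv_apply_eq_iterDirDeriv_ofFn hgl, laplacian_eq_sum_iterDirDeriv hg,
      iterDirDeriv_finset_sum _ fun i _ ↦ contDiff_iterDirDeriv hg _]
    refine Finset.sum_congr rfl fun i _ ↦ ?_
    rw [iterDirDeriv_append]
  rw [hL, hR]
  refine Finset.sum_congr rfl fun i _ ↦ ?_
  exact congrFun (iterDirDeriv_perm hg List.perm_append_comm) x

end IterDir

/-! ### Operator norms of multilinear maps through basis tuples -/

section MultilinearNorm

omit [MeasurableSpace E] [BorelSpace E] in
/-- **Operator norm through basis tuples**: for a continuous multilinear map `T` on a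
finite-dimensional inner product space with orthonormal basis `(eᵢ)`,
`‖T‖ ≤ Σ_{idx} ‖T(e_{idx 1}, …, e_{idx j})‖` (expand each argument in the basis; the
coordinates are bounded by the norms). [folklore] -/
theorem ContinuousMultilinearMap.norm_le_sum_norm_apply_basis {j : ℕ}
    (T : ContinuousMultilinearMap ℝ (fun _ : Fin j ↦ E) F) :
    ‖T‖ ≤ ∑ idx : Fin j → Fin (Module.finrank ℝ E),
      ‖T fun l ↦ stdOrthonormalBasis ℝ E (idx l)‖ := by
  classical
  set b := stdOrthonormalBasis ℝ E
  refine ContinuousMultilinearMap.opNorm_le_bound (Finset.sum_nonneg fun _ _ ↦ norm_nonneg _)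
    fun v ↦ ?_
  -- expand every argument in the basis
  have hexp : (v : Fin j → E) = fun l ↦ ∑ i, (⟪b i, v l⟫) • b i := by
    funext l
    exact (b.sum_repr' (v l)).symm
  have hsum : T v = ∑ idx : Fin j → Fin (Module.finrank ℝ E),
      T fun l ↦ (⟪b (idx l), v l⟫) • b (idx l) := by
    conv_lhs => rw [hexp]
    exact T.toMultilinearMap.map_sum (fun l i ↦ (⟪b i, v l⟫) • b i)
  rw [hsum]
  refine (norm_sum_le _ _).trans ?_
  rw [Finset.sum_mul]
  refine Finset.sum_le_sum fun idx _ ↦ ?_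
  rw [T.map_smul_univ, norm_smul, mul_comm]
  refine mul_le_mul_of_nonneg_left ?_ (norm_nonneg _)
  rw [norm_prod]
  refine Finset.prod_le_prod (fun l _ ↦ norm_nonneg _) fun l _ ↦ ?_
  rw [Real.norm_eq_abs]
  calc |⟪b (idx l), v l⟫| ≤ ‖b (idx l)‖ * ‖v l‖ := abs_real_inner_le_norm _ _
    _ = ‖v l‖ := by rw [b.orthonormal.1, one_mul]

/-- The operator norms of the iterated derivatives of an admissible datum are bounded.
[folklore] -/
theorem IsHeatAdmissible.exists_bound_iteratedFDeriv {F' : Type*} [NormedAddCommGroup F']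
    [InnerProductSpace ℝ F'] {h : E → F'} (hh : IsHeatAdmissible h) (j : ℕ) :
    ∃ C : ℝ, ∀ x, ‖iteratedFDeriv ℝ j h x‖ ≤ C := by
  classical
  set b := stdOrthonormalBasis ℝ E
  choose C hC using fun idx : Fin j → Fin (Module.finrank ℝ E) ↦
    hh.bounded (List.ofFn fun l ↦ b (idx l))
  refine ⟨∑ idx, C idx, fun x ↦ ?_⟩
  refine (ContinuousMultilinearMap.norm_le_sum_norm_apply_basis _).trans (Finset.sum_le_sum fun idx _ ↦ ?_)
  rw [iteratedFDeriv_apply_eq_iterDirDeriv_ofFn hh.contDiff]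
  exact hC idx x

end MultilinearNorm

/-! ### Spatial derivatives of every order fall on bounded smooth data -/

section HeatExtension

variable [CompleteSpace F]

omit [MeasurableSpace E] [BorelSpace E] [CompleteSpace F] [FiniteDimensional ℝ E] in
set_option maxSynthPendingDepth 3 in
/-- `‖D(DᵏG)‖ = ‖Dᵏ⁺¹G‖`-type bound for the second derivative of an iterated derivative:
`‖D(D(Dᵏg))(z)‖ ≤ ‖Dᵏ⁺²g(z)‖`. [folklore] -/
theorem norm_fderiv_fderiv_iteratedFDeriv_le {g : E → F} (k : ℕ) (z : E) :
    ‖fderiv ℝ (fderiv ℝ (iteratedFDeriv ℝ k g)) z‖ ≤ ‖iteratedFDeriv ℝ (k + 2) g z‖ := by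
  rw [fderiv_iteratedFDeriv]
  set iso := continuousMultilinearCurryLeftEquiv ℝ (fun _ : Fin (k + 1) ↦ E) F
  rw [iso.comp_fderiv']
  have hiso : ‖(iso : (E [×(k + 1)]→L[ℝ] F) →L[ℝ] (E →L[ℝ] E [×k]→L[ℝ] F))‖ ≤ 1 :=
    ContinuousLinearMap.opNorm_le_bound _ zero_le_one fun v ↦ by
      simp
  calc ‖(iso : (E [×(k + 1)]→L[ℝ] F) →L[ℝ] (E →L[ℝ] E [×k]→L[ℝ] F)).comp
        (fderiv ℝ (iteratedFDeriv ℝ (k + 1) g) z)‖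
      ≤ ‖(iso : (E [×(k + 1)]→L[ℝ] F) →L[ℝ] (E →L[ℝ] E [×k]→L[ℝ] F))‖ *
          ‖fderiv ℝ (iteratedFDeriv ℝ (k + 1) g) z‖ := ContinuousLinearMap.opNorm_comp_le _ _
    _ ≤ 1 * ‖fderiv ℝ (iteratedFDeriv ℝ (k + 1) g) z‖ :=
        mul_le_mul_of_nonneg_right hiso (norm_nonneg _)
    _ = ‖iteratedFDeriv ℝ (k + 2) g z‖ := by rw [one_mul, norm_fderiv_iteratedFDeriv]

/-- Continuity at the initial time along `s ↦ (νs, x)`, general codomain. [folklore] -/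
theorem tendsto_heatExtension_mul_nhdsGT' {G : E → F} (hG : Continuous G) {C : ℝ}
    (hC : ∀ z, ‖G z‖ ≤ C) {ν : ℝ} (hν : 0 < ν) (x : E) :
    Tendsto (fun s : ℝ ↦ heatExtension G (ν * s) x) (𝓝[>] 0) (𝓝 (G x)) := by
  have h := tendsto_heatExtension_nhdsWithin_prod hG hC x
  have hφ : Tendsto (fun s : ℝ ↦ ((ν * s, x) : ℝ × E)) (𝓝[>] 0) (𝓝[Ioi 0 ×ˢ univ] ((0 : ℝ), x)) := by
    have hc : ContinuousWithinAt (fun s : ℝ ↦ ((ν * s, x) : ℝ × E)) (Ioi 0) 0 :=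
      ((continuous_const.mul continuous_id).prodMk continuous_const).continuousWithinAt
    have h := hc.tendsto_nhdsWithin (fun s hs ↦ mem_prod.2 ⟨mul_pos hν hs, mem_univ _⟩)
    rw [mul_zero] at h
    exact h
  have h3 := h.comp hφ
  exact h3

end HeatExtension

/-! ### The spatial derivatives of the free flow: joint continuity, time derivatives -/

section FreeFlow

variable {F' : Type*} [NormedAddCommGroup F'] [InnerProductSpace ℝ F'] [FiniteDimensional ℝ F']
variable {ν : ℝ} {g : E → F'}

/-- For `t > 0` the spatial derivatives of the free flow are the heat extensions of the derived
data: `Dᵏ(e^{νtΔ}g)(x) = e^{νtΔ}(Dᵏg)(x)`. [cite: Evans2010, §2.3.1, Thm. 1] -/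
theorem iteratedFDeriv_freeFlow_of_pos (hg : IsHeatAdmissible g) (hν : 0 < ν) (k : ℕ) {t : ℝ}
    (ht : 0 < t) (x : E) :
    iteratedFDeriv ℝ k (freeFlow ν g t) x = heatExtension (iteratedFDeriv ℝ k g) (ν * t) x := by
  haveI : CompleteSpace F' := FiniteDimensional.complete ℝ F'
  choose C hC using hg.exists_bound_iteratedFDeriv
  rw [freeFlow_of_pos ν g ht, iteratedFDeriv_heatExtension_of_bounded (n := k)
    (hg.contDiff.of_le (by exact_mod_cast le_top)) (fun j _ z ↦ hC j z) (mul_pos hν ht) k le_rfl]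

omit [FiniteDimensional ℝ F'] in
/-- For `t ≤ 0` the free flow is the datum. [folklore] -/
theorem iteratedFDeriv_freeFlow_of_nonpos (ν : ℝ) (g : E → F') (k : ℕ) {t : ℝ} (ht : t ≤ 0) :
    iteratedFDeriv ℝ k (freeFlow ν g t) = iteratedFDeriv ℝ k g := by
  rw [freeFlow_of_nonpos ν g ht]

/-- **Joint continuity of the spatial derivatives of the free flow** `(t, x) ↦ Dᵏ(e^{νtΔ}g)(x)`
on `ℝ × E` (constant in `t ≤ 0`; `tendsto_heatExtension_nhdsWithin_prod` for the bounded
continuous datum `Dᵏg` at `t = 0`). [cite: Evans2010, §2.3.1, Thm. 1] -/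
theorem continuous_iteratedFDeriv_freeFlow (hg : IsHeatAdmissible g) (hν : 0 < ν) (k : ℕ) :
    Continuous fun p : ℝ × E ↦ iteratedFDeriv ℝ k (freeFlow ν g p.1) p.2 := by
  haveI : CompleteSpace F' := FiniteDimensional.complete ℝ F'
  set G := iteratedFDeriv ℝ k g with hGdef
  obtain ⟨C, hC⟩ := hg.exists_bound_iteratedFDeriv k
  have hGc : Continuous G := hg.contDiff.continuous_iteratedFDeriv (by norm_cast; exact le_top)
  set Ψ : ℝ × E → E [×k]→L[ℝ] F' := fun p ↦ iteratedFDeriv ℝ k (freeFlow ν g p.1) p.2 with hΨ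
  have hΨpos : ∀ p : ℝ × E, 0 < p.1 → Ψ p = heatExtension G (ν * p.1) p.2 := fun p hp ↦
    iteratedFDeriv_freeFlow_of_pos hg hν k hp p.2
  have hΨnonpos : ∀ p : ℝ × E, p.1 ≤ 0 → Ψ p = G p.2 := fun p hp ↦ by
    simp only [hΨ]
    rw [iteratedFDeriv_freeFlow_of_nonpos ν g k hp]
  -- the positive-time expression and its continuity on `(0, ∞) × E`
  have hpos : ContinuousOn (fun q : ℝ × E ↦ heatExtension G (ν * q.1) q.2) (Ioi 0 ×ˢ univ) := by
    have h1 := continuousOn_uncurry_heatExtension hGc hC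
    have hmap : MapsTo (fun q : ℝ × E ↦ (ν * q.1, q.2)) (Ioi 0 ×ˢ univ) (Ioi 0 ×ˢ univ) :=
      fun q hq ↦ mem_prod.2 ⟨mul_pos hν (mem_prod.1 hq).1, mem_univ _⟩
    have hf : Continuous fun q : ℝ × E ↦ (ν * q.1, q.2) :=
      (continuous_const.mul continuous_fst).prodMk continuous_snd
    have h2 := h1.comp hf.continuousOn hmap
    exact h2
  refine continuous_iff_continuousAt.2 fun q₀ ↦ ?_
  obtain ⟨t₀, x₀⟩ := q₀
  rcases lt_trichotomy t₀ 0 with ht₀ | rfl | ht₀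
  · -- `t₀ < 0`: locally the datum
    have heq : Ψ =ᶠ[𝓝 (t₀, x₀)] fun q ↦ G q.2 := by
      have hO : IsOpen {q : ℝ × E | q.1 < 0} := isOpen_lt continuous_fst continuous_const
      filter_upwards [hO.mem_nhds ht₀] with q hq
      exact hΨnonpos q (le_of_lt hq)
    exact (ContinuousAt.congr (hGc.comp continuous_snd).continuousAt heq.symm)
  · -- `t₀ = 0`
    have hunion : ({q : ℝ × E | q.1 ≤ 0} ∪ Ioi 0 ×ˢ univ) = univ := by
      ext q
      simp only [mem_union, mem_setOf_eq, mem_prod, mem_Ioi, mem_univ, and_true, iff_true]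
      exact le_or_gt q.1 0
    have h0 : Ψ (0, x₀) = G x₀ := hΨnonpos (0, x₀) le_rfl
    rw [← continuousWithinAt_univ, ← hunion, continuousWithinAt_union]
    constructor
    · exact (hGc.comp continuous_snd).continuousWithinAt.congr (fun q hq ↦ hΨnonpos q hq) h0
    · have ht := tendsto_heatExtension_nhdsWithin_prod hGc hC x₀
      have hmap : Tendsto (fun q : ℝ × E ↦ (ν * q.1, q.2)) (𝓝[Ioi 0 ×ˢ univ] ((0 : ℝ), x₀))
          (𝓝[Ioi 0 ×ˢ univ] ((0 : ℝ), x₀)) := by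
        have hc : ContinuousWithinAt (fun q : ℝ × E ↦ (ν * q.1, q.2)) (Ioi 0 ×ˢ univ) (0, x₀) :=
          ((continuous_const.mul continuous_fst).prodMk continuous_snd).continuousWithinAt
        have h := hc.tendsto_nhdsWithin (fun q hq ↦ mem_prod.2 ⟨mul_pos hν (mem_prod.1 hq).1, mem_univ _⟩)
        rw [mul_zero] at h
        exact h
      have h2 := ht.comp hmap
      rw [ContinuousWithinAt, h0]
      refine h2.congr' ?_
      filter_upwards [self_mem_nhdsWithin] with q hq
      exact (hΨpos q (mem_prod.1 hq).1).symm
  · -- `t₀ > 0`: locally the heat extension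
    have heq : Ψ =ᶠ[𝓝 (t₀, x₀)] fun q ↦ heatExtension G (ν * q.1) q.2 := by
      have hO : IsOpen {q : ℝ × E | 0 < q.1} := isOpen_lt continuous_const continuous_fst
      filter_upwards [hO.mem_nhds ht₀] with q hq
      exact hΨpos q hq
    have hO : IsOpen (Ioi (0 : ℝ) ×ˢ (univ : Set E)) := isOpen_Ioi.prod isOpen_univ
    exact (hpos.continuousAt (hO.mem_nhds (mem_prod.2 ⟨mem_Ioi.2 ht₀, mem_univ _⟩))).congr heq.symm

set_option maxSynthPendingDepth 3 in
/-- The time derivative of the spatial derivatives of the free flow at positive times: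
`∂ₜ Dᵏ(e^{νtΔ}g)(x) = ν Dᵏ(e^{νtΔ}(Δg))(x)` (the heat equation for the datum `Dᵏg` and
`Δ Dᵏ = Dᵏ Δ`). [cite: Evans2010, §2.3.1, Thm. 1] -/
theorem hasDerivAt_iteratedFDeriv_freeFlow_of_pos (hg : IsHeatAdmissible g) (hν : 0 < ν) (k : ℕ)
    {t : ℝ} (ht : 0 < t) (x : E) :
    HasDerivAt (fun τ ↦ iteratedFDeriv ℝ k (freeFlow ν g τ) x)
      (ν • iteratedFDeriv ℝ k (freeFlow ν (Δ g) t) x) t := by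
  haveI : CompleteSpace F' := FiniteDimensional.complete ℝ F'
  set G := iteratedFDeriv ℝ k g with hGdef
  have hgk : ContDiff ℝ ∞ G := hg.contDiff.iteratedFDeriv_right (by norm_cast)
  obtain ⟨C₀, hC₀⟩ := hg.exists_bound_iteratedFDeriv k
  obtain ⟨C₁, hC₁⟩ := hg.exists_bound_iteratedFDeriv (k + 1)
  obtain ⟨C₂, hC₂⟩ := hg.exists_bound_iteratedFDeriv (k + 2)
  have h1 : ∀ z, ‖fderiv ℝ G z‖ ≤ C₁ := fun z ↦ by rw [hGdef, norm_fderiv_iteratedFDeriv]; exact hC₁ z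
  have h2 : ∀ z, ‖fderiv ℝ (fderiv ℝ G) z‖ ≤ C₂ := fun z ↦
    (norm_fderiv_fderiv_iteratedFDeriv_le k z).trans (hC₂ z)
  -- the heat equation for the datum `G`, composed with `τ ↦ ντ`
  have hheat : HasDerivAt (fun τ ↦ heatExtension G (ν * τ) x) (ν • heatExtension (Δ G) (ν * t) x) t := by
    have h := hasDerivAt_heatExtension_time_of_bounded (hgk.of_le (by norm_cast)) hC₀ h1 h2 (mul_pos hν ht) x
    have hc : HasDerivAt (fun τ : ℝ ↦ ν * τ) ν t := by
      simpa using (hasDerivAt_id t).const_mul ν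
    exact h.scomp t hc
  -- `Δ G = Dᵏ(Δg)`, and back to the free flow of `Δg`
  have hΔ : Δ G = iteratedFDeriv ℝ k (Δ g) := funext fun z ↦ laplacian_iteratedFDeriv_eq hg.contDiff k z
  have hval : heatExtension (Δ G) (ν * t) x = iteratedFDeriv ℝ k (freeFlow ν (Δ g) t) x := by
    rw [hΔ, iteratedFDeriv_freeFlow_of_pos hg.laplacian hν k ht x]
  rw [hval] at hheat
  refine hheat.congr_of_eventuallyEq ?_
  filter_upwards [Ioi_mem_nhds ht] with τ hτ
  exact iteratedFDeriv_freeFlow_of_pos hg hν k hτ x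

/-- **The time derivative of the spatial derivatives of the free flow within `[0, ∞)`**
(one-sided at `t = 0`): `HasDerivWithinAt (τ ↦ Dᵏ(e^{ντΔ}g)(x)) (ν Dᵏ(e^{νtΔ}(Δg))(x)) [0, ∞) t`
for `t ≥ 0` and admissible `g`. [cite: Evans2010, §2.3.1, Thm. 1] -/
theorem hasDerivWithinAt_iteratedFDeriv_freeFlow (hg : IsHeatAdmissible g) (hν : 0 < ν) (k : ℕ)
    {t : ℝ} (ht : 0 ≤ t) (x : E) :
    HasDerivWithinAt (fun τ ↦ iteratedFDeriv ℝ k (freeFlow ν g τ) x)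
      (ν • iteratedFDeriv ℝ k (freeFlow ν (Δ g) t) x) (Ici 0) t := by
  rcases ht.eq_or_lt with rfl | ht'
  · refine hasDerivWithinAt_Ici_of_tendsto_deriv (s := Ioi 0) ?_ ?_ self_mem_nhdsWithin ?_
    · exact fun s hs ↦ (hasDerivAt_iteratedFDeriv_freeFlow_of_pos hg hν k hs x).differentiableAt.differentiableWithinAt
    · exact ((continuous_iteratedFDeriv_freeFlow hg hν k).comp
        (continuous_id.prodMk (continuous_const (y := x)))).continuousWithinAt
    · have hc := ((continuous_iteratedFDeriv_freeFlow hg.laplacian hν k).comp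
        (continuous_id.prodMk (continuous_const (y := x)))).continuousWithinAt (s := Ioi 0) (x := (0 : ℝ))
      have h := hc.tendsto.const_smul ν
      refine h.congr' ?_
      filter_upwards [self_mem_nhdsWithin] with s hs
      simp only [comp_apply, id_eq]
      exact ((hasDerivAt_iteratedFDeriv_freeFlow_of_pos hg hν k hs x).deriv).symm
  · exact (hasDerivAt_iteratedFDeriv_freeFlow_of_pos hg hν k ht' x).hasDerivWithinAt

/-! ### Smoothness up to the initial time -/

omit [FiniteDimensional ℝ F'] in
/-- Iterated Laplacians of admissible data are admissible. [folklore] -/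
theorem isHeatAdmissible_iterate_laplacian (hg : IsHeatAdmissible g) :
    ∀ l : ℕ, IsHeatAdmissible ((fun h : E → F' ↦ Δ h)^[l] g)
  | 0 => hg
  | l + 1 => by
    rw [Function.iterate_succ_apply']
    exact (isHeatAdmissible_iterate_laplacian hg l).laplacian

/-- **The free flow of an admissible datum is smooth up to the initial time**: the extended free
flow `(t, x) ↦ e^{νtΔ}g(x)` (`= g(x)` for `t ≤ 0`) is `C^∞` on `[0, ∞) ×ˢ univ` in the within
sense (`contDiffOn_uncurry_of_mixed_partials_within` for the fields `w l = νˡ e^{νtΔ}(Δˡg)`).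
[cite: Evans2010, §2.3.1, Thm. 1] -/
theorem contDiffOn_uncurry_freeFlow (hg : IsHeatAdmissible g) (hν : 0 < ν) :
    ContDiffOn ℝ ∞ (uncurry (freeFlow ν g)) (Ici 0 ×ˢ univ) := by
  set w : ℕ → ℝ → E → F' := fun l t x ↦ ν ^ l • freeFlow ν ((fun h : E → F' ↦ Δ h)^[l] g) t x
    with hw
  have hadm : ∀ l, IsHeatAdmissible ((fun h : E → F' ↦ Δ h)^[l] g) := isHeatAdmissible_iterate_laplacian hg
  -- the spatial derivatives of the fields `w l`
  have hD : ∀ k l t x, iteratedFDeriv ℝ k (w l t) x =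
      ν ^ l • iteratedFDeriv ℝ k (freeFlow ν ((fun h : E → F' ↦ Δ h)^[l] g) t) x := by
    intro k l t x
    simp only [hw]
    rw [show (fun x ↦ ν ^ l • freeFlow ν ((fun h : E → F' ↦ Δ h)^[l] g) t x) =
        ν ^ l • freeFlow ν ((fun h : E → F' ↦ Δ h)^[l] g) t from rfl]
    exact iteratedFDeriv_const_smul_apply
      ((((hadm l).freeFlow hν t).contDiff.of_le (by exact_mod_cast le_top)).contDiffAt)
  have hx : ∀ l, ∀ t ∈ Ici (0 : ℝ), ContDiff ℝ ∞ (w l t) := fun l t _ ↦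
    contDiff_const.smul ((hadm l).freeFlow hν t).contDiff
  have ht : ∀ k l : ℕ, ∀ t ∈ Ici (0 : ℝ), ∀ x : E,
      HasDerivWithinAt (fun τ ↦ iteratedFDeriv ℝ k (w l τ) x) (iteratedFDeriv ℝ k (w (l + 1) t) x)
        (Ici 0) t := by
    intro k l t ht x
    have h := (hasDerivWithinAt_iteratedFDeriv_freeFlow (hadm l) hν k ht x).const_smul (ν ^ l)
    have heq : (ν ^ l • fun τ ↦ iteratedFDeriv ℝ k (freeFlow ν ((fun h : E → F' ↦ Δ h)^[l] g) τ) x) =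
        fun τ ↦ iteratedFDeriv ℝ k (w l τ) x := funext fun τ ↦ by
      simp only [Pi.smul_apply]
      exact (hD k l τ x).symm
    rw [heq] at h
    have hval : ν ^ l • (ν • iteratedFDeriv ℝ k (freeFlow ν (Δ ((fun h : E → F' ↦ Δ h)^[l] g)) t) x) =
        iteratedFDeriv ℝ k (w (l + 1) t) x := by
      rw [hD k (l + 1) t x, Function.iterate_succ_apply', smul_smul, pow_succ]
    rw [hval] at h
    exact h
  have hc : ∀ k l : ℕ, ContinuousOn (fun p : ℝ × E ↦ iteratedFDeriv ℝ k (w l p.1) p.2) (Ici 0 ×ˢ univ) := by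
    intro k l
    have h := (continuous_iteratedFDeriv_freeFlow (hadm l) hν k).const_smul (ν ^ l)
    refine (h.continuousOn (s := Ici 0 ×ˢ univ)).congr fun p _ ↦ ?_
    exact hD k l p.1 p.2
  have h := contDiffOn_uncurry_of_mixed_partials_within (convex_Ici 0) (uniqueDiffOn_Ici 0) hx ht hc 0
  refine h.congr fun p _ ↦ ?_
  simp [hw, uncurry]

/-- The same in `IsSmoothSpaceTimeOn` form. [cite: Evans2010, §2.3.1, Thm. 1] -/
theorem isSmoothSpaceTimeOn_freeFlow_Ici (hg : IsHeatAdmissible g) (hν : 0 < ν) :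
    Literature.Analysis.FluidPDE.IsSmoothSpaceTimeOn (Ici 0) (freeFlow ν g) :=
  contDiffOn_uncurry_freeFlow hg hν

end FreeFlow

end Literature.Analysis.PDE

end
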